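import Summits.HubbardSuperconductivity.HubbardSuperconductivity.Theorems.AnisotropyChordTransferFibre3BetaFreeTargets

/-!
# Route `AnisotropyChord` / H0 rotor rung: PORT PartN33 — (KT-1) AT LEVEL 1: THE REDUCTION OF THE TRIAL GAP TO NAMED ONE-LOOP SUMS, AND THE N-TERM LAYER

Verbatim port (modulo this header, the port comment and lint options) of the theory seat's statement file
`hubbard-h0-rotor-theory-1/cycle21/lean/PartN33.lean` (sha16 `a16d505958b7798c`; theory seat `hubbard-h0-rotor-theory-1` g21).
Statements only (targets typed by the theory seat; no proofs claimed here beyond what the theory file itself proves).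
Prover seat `hubbard-h0-rotor-p1` g22; helper for stmt-HubbardSuperconductivity-19089 (`--supports`).

Theory seat's own summary of the file:

# PartN33 — (KT-1) at Level 1: the trial-gap identity `N₁ = −(ε₁ + T⁺ − 3λ₂)·B − (ε₁/2)·G₂ + B_C`,
the explicit cross term `C0`, the ONE-LOOP (single momentum sum) forms of `‖Π⁰‖², A(x̂), B, ⟨Π⁰,C0⟩, B_C`,
and the tail toolkit T3 (theory seat hubbard-h0-rotor-theory-1, generation 21; memo ROTOR-THEORY-21 §297(A),(B), §298(a),(b)).
Statements only (Props + defs), each verified numerically to ≤ 1e-10 relative at L = 8, 12 (cycle21/calc/lib21.py,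
oneloop_check33.py).  Conventions: `dft g k = Σ_r e^{−ik·r} g(r)` (tree), `F₂ := Re dft[f²]`, `D_e f(r) := f(r) − f(r−e)`,
`φ_e := f·D_e f`, `κ(c) := (|v(c)|² − 3)/2 = Σ_pairs cos(θ rₓ)`.

THE (KT-1) LEVEL-1 THEOREM (memo 21 §298(b)) is then: N₁ ≥ N₁⁻ := an explicit expression in the closed forms, `‖s‖²`,
and the named values `t(q), τ_e(q)` (`|Lq/2π|∞ ≤ 2`, `q = ±K₁`), obtained from the identities below by replacing every TAIL
value `t(k)`, `τ_e(k)` by the intervals of `TtailBounds` / `TauTailBound` and doing interval arithmetic on polynomials of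
degree ≤ 3 (evaluator: cycle21/calc/kt1_bound.py; c₁″_LB table in §298(c)).  That final assembled inequality is typed at
Level 2 together with the master lemma (it needs the enclosures of the named sums to be a closed statement).
-/

-- Port of theory seat `hubbard-h0-rotor-theory-1` cycle21/lean/PartN33.lean (sha16 a16d505958b7798c) verbatim modulo this header,
-- lint options and lint fixes; prover seat `hubbard-h0-rotor-p1` g22, `--supports stmt-HubbardSuperconductivity-19089`.

set_option linter.dupNamespace false
noncomputable section

open scoped BigOperators
open Complex

namespace Summit.HubbardSuperconductivity.HubbardSuperconductivity.Theorems.AnisotropyChord.Transfer.Fibre3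

variable (L : ℕ) [NeZero L]

/-! ## Layer A — the N₁ identity (pure algebra from `DiscreteIMS`, the definition of `T⁺`, and `f(0) = 0`) -/

/-- the real product state `Π⁰(a,b) = f(a) f(b) f(b − a)` (`prodState = (piR : ℂ)`). -/
def piR (f : Tor L → ℝ) (c : Cfg L) : ℝ := f c.1 * f c.2 * f (c.2 - c.1)

/-- `κ(c) = (|v(c)|² − 3)/2 = cos θaₓ + cos θbₓ + cos θ(b−a)ₓ`. -/
def kapV (c : Cfg L) : ℝ := (Complex.normSq (vfun L c) - 3) / 2

/-- `‖Π⁰‖²`. -/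
def PiNormSq (f : Tor L → ℝ) : ℝ := ∑ c : Cfg L, piR L f c ^ 2

/-- `B := 2⟨κΠ⁰, Π⁰⟩` (negative; one loop: `(6/V) Σ_k F₂(k)² F₂(k+K₁)`). -/
def Bterm (f : Tor L → ℝ) : ℝ := 2 * ∑ c : Cfg L, kapV L c * piR L f c ^ 2

/-- the contact correlation `A(x̂) := Σ_b f(b)² f(b − x̂)²`. -/
def Axhat (f : Tor L → ℝ) : ℝ := ∑ b : Tor L, f b ^ 2 * f (b - K1 L) ^ 2

/-- `G₂ := Σ_c Σ_{three +x̂ hops} (Π⁰(hop c) − Π⁰(c))²` (the hops of `DiscreteIMS`: `(a+x̂,b)`, `(a,b+x̂)`, `(a−x̂,b−x̂)`). -/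
def G2term (f : Tor L → ℝ) : ℝ :=
  ∑ c : Cfg L, ((piR L f (c.1 + K1 L, c.2) - piR L f c) ^ 2 + (piR L f (c.1, c.2 + K1 L) - piR L f c) ^ 2
    + (piR L f (c.1 - K1 L, c.2 - K1 L) - piR L f c) ^ 2)

/-- the `K = 0` CROSS TERM `C0 := 1_{Dᶜ}·((H⁰ − ΔW) − 3λ₂)Π⁰` (real). -/
def C0fn (Δ lam2 : ℝ) (f : Tor L → ℝ) (c : Cfg L) : ℝ :=
  if InD L c then 0 else (Happly L 0 Δ (prodState L f) c).re - 3 * lam2 * piR L f c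

/-- `B_C := 2⟨κΠ⁰, C0⟩`. -/
def BCterm (Δ lam2 : ℝ) (f : Tor L → ℝ) : ℝ := 2 * ∑ c : Cfg L, kapV L c * piR L f c * C0fn L Δ lam2 f c

/-- ★ THE N₁ IDENTITY (memo 21 §297(B)): `N₁ = −(ε₁ + T⁺ − 3λ₂)·B − (ε₁/2)·G₂ + B_C`
(`DiscreteIMS` + `Σ_c Π(c)Π(c+s) = ‖Π‖² − ½‖Π∘s − Π‖²` + `⟨Π,(H⁰−T⁺)Π⟩ = 0` + `Π = 0` on `D`; holds for any `lam2`). -/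
def N1Identity (Δ : ℝ) : Prop :=
  ∀ lam2 : ℝ, ∀ f : Tor L → ℝ, IsTwoMagnon L Δ lam2 f →
    trialGapN1 L Δ f
      = -(eps1 L + Tplus L Δ f - 3 * lam2) * Bterm L f - eps1 L / 2 * G2term L f + BCterm L Δ lam2 f

/-! ## Layer B — the explicit cross term and the one-loop forms -/

/-- `D_e f(r) := f(r) − f(r − e)`. -/
def Dgrad (f : Tor L → ℝ) (e r : Tor L) : ℝ := f r - f (r - e)

/-- C0 EXPLICIT (the product rule + the two-magnon equation of each pair factor off the origin; 12 terms):
`C0(a,b) = −½ Σ_e [ f(c)·D_e f(a)·D_e f(b) + f(b)·D_{−e} f(a)·D_e f(c) + f(a)·D_e f(b)·D_e f(c) ]`, `c = b − a`, `(a,b) ∉ D`. -/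
def C0Explicit (Δ : ℝ) : Prop :=
  ∀ lam2 : ℝ, ∀ f : Tor L → ℝ, IsTwoMagnon L Δ lam2 f → ∀ c : Cfg L, InD L c = false →
    C0fn L Δ lam2 f c
      = -(1 / 2) * ((nnList L).map (fun e =>
          f (c.2 - c.1) * Dgrad L f e c.1 * Dgrad L f e c.2 + f c.2 * Dgrad L f (-e) c.1 * Dgrad L f e (c.2 - c.1)
            + f c.1 * Dgrad L f e c.2 * Dgrad L f e (c.2 - c.1))).sum

/-- `F₂(k) := Re FT[f²](k)` (`FT[f²]` is real for even `f`). -/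
def F2 (f : Tor L → ℝ) (k : Tor L) : ℝ := (dft L (fun r => f r ^ 2) k).re

/-- `φ̂_e(k) := FT[f·D_e f](k)`. -/
def phiHat (f : Tor L → ℝ) (e k : Tor L) : ℂ := dft L (fun r => f r * Dgrad L f e r) k

/-- `‖Π⁰‖² = (1/V) Σ_k F₂(k)³` (even `f`). -/
def PiNormOneLoop : Prop :=
  ∀ f : Tor L → ℝ, (∀ r : Tor L, f (-r) = f r) → PiNormSq L f = (∑ k : Tor L, F2 L f k ^ 3) / (L : ℝ) ^ 2

/-- `A(x̂) = (1/V) Σ_k F₂(k)² cos kₓ` (even `f`). -/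
def AxhatOneLoop : Prop :=
  ∀ f : Tor L → ℝ, (∀ r : Tor L, f (-r) = f r) →
    Axhat L f = (∑ k : Tor L, F2 L f k ^ 2 * Real.cos (2 * Real.pi * k.1.val / L)) / (L : ℝ) ^ 2

/-- `B = (6/V) Σ_k F₂(k)² F₂(k + K₁)` (even `f`: `Π⁰²` is `S₃`-symmetric, each pair phase gives one third). -/
def BtermOneLoop : Prop :=
  ∀ f : Tor L → ℝ, (∀ r : Tor L, f (-r) = f r) →
    Bterm L f = 6 * (∑ k : Tor L, F2 L f k ^ 2 * F2 L f (k + K1 L)) / (L : ℝ) ^ 2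

/-- `G₂ = T⁺‖Π⁰‖² + 12Δ f_nn² A(x̂)` (`= ⟨Π⁰, (H⁰−ΔW)Π⁰⟩ + Δ⟨WΠ⁰,Π⁰⟩` by the hop symmetries; needs `f` even and
swap-symmetric, `f(y,x) = f(x,y)`). -/
def G2OneLoopForm (Δ : ℝ) : Prop :=
  ∀ lam2 : ℝ, ∀ f : Tor L → ℝ, IsTwoMagnon L Δ lam2 f → (∀ r : Tor L, f (-r) = f r) → (∀ r : Tor L, f (r.2, r.1) = f r) →
    G2term L f = Tplus L Δ f * PiNormSq L f + 12 * Δ * f (K1 L) ^ 2 * Axhat L f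

/-- `⟨Π⁰, C0⟩ = −(3/2) Σ_e (1/V) Σ_k |φ̂_e(k)|² F₂(k)` (defines `δ₃`: `⟨Π⁰,C0⟩ = (T⁺ − 3λ₂)‖Π⁰‖²`). -/
def PiC0OneLoop (Δ : ℝ) : Prop :=
  ∀ lam2 : ℝ, ∀ f : Tor L → ℝ, IsTwoMagnon L Δ lam2 f → (∀ r : Tor L, f (-r) = f r) →
    (∑ c : Cfg L, piR L f c * C0fn L Δ lam2 f c)
      = -(3 / 2) * ((nnList L).map (fun e =>
          (∑ k : Tor L, Complex.normSq (phiHat L f e k) * F2 L f k) / (L : ℝ) ^ 2)).sum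

/-- `B_C = −3 Σ_e J_e`, `J_e = (1/V) Σ_k { Re[conj(φ̂_e(k)) φ̂_e(k+K₁)]·(F₂(k) + F₂(k+K₁)) + |φ̂_e(k)|² F₂(k+K₁) }` (even `f`). -/
def BCOneLoop (Δ : ℝ) : Prop :=
  ∀ lam2 : ℝ, ∀ f : Tor L → ℝ, IsTwoMagnon L Δ lam2 f → (∀ r : Tor L, f (-r) = f r) →
    BCterm L Δ lam2 f
      = -3 * ((nnList L).map (fun e =>
          (∑ k : Tor L, (((starRingEnd ℂ) (phiHat L f e k) * phiHat L f e (k + K1 L)).re * (F2 L f k + F2 L f (k + K1 L))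
              + Complex.normSq (phiHat L f e k) * F2 L f (k + K1 L))) / (L : ℝ) ^ 2)).sum

/-! ## Layer C — the tail toolkit T3 (memo 21 §298(a)); `s` = the small part of the pair function (PartN32 `sfun`),
`ŝ(k) = c_s g(k)` (`k ≠ 0`) with `g = 1/(2ε − λ₂)`, `c_s = f_nn(4(1−Δ) + Δλ₂)` (from `TwoMagnonFourier`). -/

/-- `s(0) = 1 − Δf_nn`, `s(r) = 1 − f(r)` (`r ≠ 0`) (same as PartN32 `sfun`; repeated to keep this file independent of PartN32). -/
def sfun' (Δ : ℝ) (f : Tor L → ℝ) : Tor L → ℝ := fun r => if r = 0 then 1 - Δ * f (K1 L) else 1 - f r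

/-- `t(k) := FT[s²](k)` (real: `s` even). -/
def tfun (Δ : ℝ) (f : Tor L → ℝ) (k : Tor L) : ℝ := (dft L (fun r => sfun' L Δ f r ^ 2) k).re

/-- `τ_e(k) := FT[(D_e s)²](k)`. -/
def taufun (Δ : ℝ) (f : Tor L → ℝ) (e k : Tor L) : ℝ := (dft L (fun r => Dgrad L (sfun' L Δ f) e r ^ 2) k).re

/-- `c_s := f_nn (4(1−Δ) + Δλ₂)`. -/
def cS (Δ lam2 : ℝ) (f : Tor L → ℝ) : ℝ := f (K1 L) * (4 * (1 - Δ) + Δ * lam2)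

/-- `G(0) := (1/V) Σ_{k≠0} 1/(2ε(k) − λ₂)` (closed form in `λ₂` by `GreenZeroIdentity`). -/
def Gzero (lam2 : ℝ) : ℝ := (∑ k ∈ (Finset.univ : Finset (Tor L)).erase 0, 1 / (2 * epsT L k - lam2)) / (L : ℝ) ^ 2

/-- T3(i) TAIL BOUNDS FOR `t` (PROVED in memo 21 §298(a): `t = (1/V)[2ŝ(0)ŝ(k) + Σ_{p≠0,k} ŝ(p)ŝ(k−p)]`, `g > 0`,
`g(p)g(k−p) ≤ (g(p)+g(k−p))/(ε(k) − 2λ₂)` from `(2ε(p)−λ₂) + (2ε(k−p)−λ₂) ≥ ε(k) − 2λ₂`, and `t ≤ Σ s² = ‖s‖²`):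
for `k ≠ 0`, `−2Δ f_nn c_s g(k)/V ≤ t(k) ≤ min(‖s‖², 2c_s² G(0)/(ε(k) − 2λ₂))`. -/
def TtailBounds (Δ : ℝ) : Prop :=
  ∀ lam2 : ℝ, ∀ f : Tor L → ℝ, IsGroundTwoMagnon L Δ lam2 f → 0 < lam2 → 2 * lam2 < eps1 L → ∀ k : Tor L, k ≠ 0 →
    -(2 * Δ * f (K1 L) * cS L Δ lam2 f / (2 * epsT L k - lam2)) / (L : ℝ) ^ 2 ≤ tfun L Δ f k ∧
    tfun L Δ f k ≤ ∑ r : Tor L, sfun' L Δ f r ^ 2 ∧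
    tfun L Δ f k ≤ 2 * cS L Δ lam2 f ^ 2 * Gzero L lam2 / (epsT L k - 2 * lam2)

/-- T3(ii) `|τ_e(k)| ≤ τ_e(0) = ‖D_e s‖²` (Fourier transform of a non-negative function). -/
def TauTailBound (Δ : ℝ) : Prop :=
  ∀ f : Tor L → ℝ, ∀ e k : Tor L, |taufun L Δ f e k| ≤ ∑ r : Tor L, Dgrad L (sfun' L Δ f) e r ^ 2

/-- the closed form of `‖D_e s‖²` (memo 21 §297(A): `= 2η_eff(1 − Δf_nn + ‖h‖²/V)`, `η_eff = Vλ₂/4`,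
`‖h‖² = 1 + ‖s‖² − (1 − Δf_nn)²`), for `e` a nearest neighbour. -/
def GradSNormClosed (Δ : ℝ) : Prop :=
  ∀ lam2 : ℝ, ∀ f : Tor L → ℝ, IsGroundTwoMagnon L Δ lam2 f → ∀ e ∈ nnList L,
    (∑ r : Tor L, Dgrad L (sfun' L Δ f) e r ^ 2)
      = 2 * etaEff L lam2 * (1 - Δ * f (K1 L)
          + (1 + (∑ r : Tor L, sfun' L Δ f r ^ 2) - (1 - Δ * f (K1 L)) ^ 2) / (L : ℝ) ^ 2)

/-! ## Layer D — the N-term of (KT-2b) at Level 1 (memo 21 §307): `‖N‖² ≤ 9‖C0′‖²`, `‖C0′‖² = ‖C0‖² − (T⁺−3λ₂)²‖Π⁰‖²`,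
and the PARTICLE-SPLIT / LAG-CORRELATION bound `‖C0‖²_{W=0} ≤ (9/4) M² Ψ` with the NAMED one-loop quantity
`Ψ := Σ_{e,e'} (Σ_{a ∉ NN ∪ {0}} D_e s(a) D_{e'} s(a))²` (route R1; measured bound/truth = 7–12 on the W = 0 part, affordable:
certificate margins stay ≥ +.08 at L ≥ 12). The contact shells (W ≥ 1, 15–27 % of ‖C0‖²) are left as an explicit finite-shell sum. -/

/-- `‖C0‖²` (off `D`; `C0fn` vanishes on `D`). -/
def nC0 (Δ lam2 : ℝ) (f : Tor L → ℝ) : ℝ := ∑ c : Cfg L, C0fn L Δ lam2 f c ^ 2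

/-- PYTHAGORAS for the `K = 0` residual at `T⁺`: `‖C0 − (T⁺−3λ₂)Π⁰‖² = ‖C0‖² − (T⁺−3λ₂)²‖Π⁰‖²`
(`⟨Π⁰, C0⟩ = (T⁺ − 3λ₂)‖Π⁰‖²` by the definition of `T⁺`). -/
def C0PrimePythagoras (Δ : ℝ) : Prop :=
  ∀ lam2 : ℝ, ∀ f : Tor L → ℝ, IsTwoMagnon L Δ lam2 f →
    (∑ c : Cfg L, (C0fn L Δ lam2 f c - (Tplus L Δ f - 3 * lam2) * piR L f c) ^ 2)
      = nC0 L Δ lam2 f - (Tplus L Δ f - 3 * lam2) ^ 2 * PiNormSq L f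

/-- `a` is REGULAR: neither the origin nor a nearest neighbour (no hard-core jump in `D_e f(a)`). -/
def IsReg (a : Tor L) : Prop := a ≠ 0 ∧ IsNN L a = false

open Classical in
/-- the lag-0 mixed gradient correlation `ψ_{e,e'} := Σ_{a regular} D_e s(a) D_{e'} s(a)` (one loop: `t`, `tₓ`-type values at lags ≤ 2). -/
def psiCorr (Δ : ℝ) (f : Tor L → ℝ) (e e' : Tor L) : ℝ :=
  ∑ a ∈ Finset.univ.filter (fun a => IsReg L a), Dgrad L (sfun' L Δ f) e a * Dgrad L (sfun' L Δ f) e' a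

/-- `Ψ := Σ_{e,e' ∈ NN} ψ_{e,e'}²`. -/
def PsiSum (Δ : ℝ) (f : Tor L → ℝ) : ℝ :=
  ((nnList L).map (fun e => ((nnList L).map (fun e' => psiCorr L Δ f e e' ^ 2)).sum)).sum

open Classical in
/-- the `W = 0` (no pair at contact) part of `‖C0‖²`. -/
def nC0free (Δ lam2 : ℝ) (f : Tor L → ℝ) : ℝ :=
  ∑ c ∈ Finset.univ.filter (fun c : Cfg L => Wcount L c = 0), C0fn L Δ lam2 f c ^ 2

/-- ★ ROUTE R1 (memo 21 §307(b)): `‖C0‖²_{W=0} ≤ (9/4)·M²·Ψ` for `|f| ≤ M`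
(`|C0|² ≤ 3Σ_i|Z_i|²`, `|Z_i|² ≤ ¼M²(Σ_e D_e s(a)D_e s(b))²` on regular pairs, and `Σ_{a,b regular}(Σ_e …)² = Ψ`). -/
def C0FreeBound (Δ : ℝ) : Prop :=
  ∀ lam2 M : ℝ, ∀ f : Tor L → ℝ, IsTwoMagnon L Δ lam2 f → (∀ r : Tor L, f (-r) = f r) → (∀ r : Tor L, |f r| ≤ M) →
    nC0free L Δ lam2 f ≤ 9 / 4 * M ^ 2 * PsiSum L Δ f

end Summit.HubbardSuperconductivity.HubbardSuperconductivity.Theorems.AnisotropyChord.Transfer.Fibre3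

end
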